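import Summits.CriticalPhenomena.CardyFormulaZ2.Theorems.CardyMagicRigidityNestingRigidityOutsideLocalityZ2
import Summits.CriticalPhenomena.CardyFormulaZ2.Theorems.CardyMagicRigidityNestingRigidityDomainEnsembleHonesty
import Literature.Probability.Percolation.OrbitLoopCloseness
import HarnessLib

/-!
# The first generation of the closed-b.c. `ℤ²` domain ensemble is a stopping set

Crux `Summit.CriticalPhenomena.CardyFormulaZ2.Theses.CardyMagicRigidity.NestingRigidity`
(stmt-CriticalPhenomena-4835), line `markov-cascade-one-generation`, registered helper
`firstGen_domLoopsZ2_eq_of_agree_outside` (wave 3, toward `stub_cascadeReconstruction`): the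
combinatorial half of the domain Markov property of the closed-boundary-condition bond-`ℤ²`
domain loop ensemble `domLoopsZ2 U δ` (definitions module `CardyMagicRigidityMarkovCascadeDefs`).

**Statement.** For `δ > 0` and bounded `U`, if two bond configurations `ω, ω'` agree on every
edge `e` whose mesh-`δ` midpoint is not strictly inside a first-generation loop of
`domLoopsZ2 U δ ω` (`u.wind (medialPoint δ e) = 0` for every `u ∈ firstGen (domLoopsZ2 U δ ω)`),
then `firstGen (domLoopsZ2 U δ ω') = firstGen (domLoopsZ2 U δ ω)`.

**Proof.** Write `β = ω ∩ meshEdges U δ`, `β' = ω' ∩ meshEdges U δ`; the loops of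
`domLoopsZ2 U δ ω` are the drawn loops `[loopCurve δ 0 γ]` of the interface loops `γ` of `β`
visiting an edge of `meshEdges U δ`, and `int γ = {z | (loopCurve δ 0 γ).wind z ≠ 0}`.
* KEY LEMMA (`wind_medialPoint_eq_zero_of_not_ssubset`): for two interface loops `γ, γ'` of ONE
  configuration with `int γ'` NOT STRICTLY inside `int γ`, every entry `e` of `γ'` has
  `wind_γ (midpoint e) = 0`.  Indeed, if `e ∈ γ` the midpoint is on the trace of `γ`; if
  `int γ' ⊆ int γ` then (no strictness) `int γ ⊆ int γ'` and the midpoint, a point of the trace of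
  `γ'`, is not inside `γ'`, hence not inside `γ`; otherwise `¬ int γ' ⊆ int γ` and this is the
  landed `mem_outsideEdges_of_mem_of_not_subset` (interior trichotomy
  `interfaceLoop_interiors_nested_or_disjoint`, module `…OutsideLocalityZ2`).
* Hence (cylinder property `isInterfaceLoop_of_forall_mem_iff`) every first-generation `γ` of `β`
  is an interface loop of `β'` (`isInterfaceLoop_of_mk_mem_firstGen`): its entries are not strictly
  inside any first-generation loop, where `ω` and `ω'` (and trivially `meshEdges U δ`) agree.
* Conversely every interface loop `L'` of `β'` not strictly inside any first-generation loop of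
  `β` is an interface loop of `β` (`isInterfaceLoop_of_forall_not_ssubset`): the key lemma in the
  configuration `β'`, between `L'` and the first-generation loops of `β` (loops of `β'` by the
  previous point).
* Assembly: a first-generation loop `[L']` of `β'` is not strictly inside a first-generation `γ`
  of `β` (a loop of `β'`), so `L'` is a loop of `β`; it is first generation there, for a loop of
  `β` strictly enclosing it is enclosed (hole-wise) by a first-generation loop of `β`
  (`exists_mem_firstGen_domLoopsZ2`: finitely many loops for bounded `U`), which would strictly
  enclose `L'`.  A first-generation `γ` of `β` is a loop of `β'`; a loop `L'` of `β'` strictly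
  enclosing it is not strictly inside any first-generation loop of `β` (else so would be `γ`), hence
  a loop of `β` strictly enclosing `γ` — impossible.  Types are `loopType` of the same lists.
-/

noncomputable section

open Set Function

namespace Summit.CriticalPhenomena.CardyFormulaZ2.Cruxes.NestingRigidity.MarkovCascadeOneGeneration

open Literature.Probability.RandomPlanarGeometry Literature.Probability.Percolation
  Literature.Probability.LatticeModels

variable {ω ω' : BondConfig (Site 2)} {γ γ' : List MedialVertex} {δ : ℝ} {U : Set ℂ}

/-! ## Entries of a loop not strictly inside `γ` are not strictly inside `γ` -/

/-- **Key lemma (mesh `1`).** For two interface loops `γ, γ'` of one configuration such that the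
winding interior of `γ'` is not STRICTLY contained in that of `γ`, the midpoint of every entry of
`γ'` has winding number `0` for `γ`. -/
theorem wind_medialPoint_eq_zero_of_not_ssubset (h : IsInterfaceLoop ω γ)
    (h' : IsInterfaceLoop ω γ')
    (hnot : ¬ {z | (loopCurve 1 0 γ').wind z ≠ 0} ⊂ {z | (loopCurve 1 0 γ).wind z ≠ 0})
    {e : MedialVertex} (he : e ∈ γ') : (loopCurve 1 0 γ).wind (medialPoint 1 e) = 0 := by
  by_cases heγ : e ∈ γ
  · exact (loopCurve 1 0 γ).wind_of_mem_range (medialPoint_mem_range_loopCurve γ heγ)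
  by_cases hsub : {z | (loopCurve 1 0 γ').wind z ≠ 0} ⊆ {z | (loopCurve 1 0 γ).wind z ≠ 0}
  · -- the interiors coincide: the midpoint lies on the trace of `γ'`, so it is not inside `γ'`
    have hrev : {z | (loopCurve 1 0 γ).wind z ≠ 0} ⊆ {z | (loopCurve 1 0 γ').wind z ≠ 0} := by
      by_contra hrev
      exact hnot ⟨hsub, hrev⟩
    by_contra hm
    exact hrev hm ((loopCurve 1 0 γ').wind_of_mem_range (medialPoint_mem_range_loopCurve γ' he))
  · exact (mem_outsideEdges_of_mem_of_not_subset h h' hsub he heγ).1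

/-- Winding numbers at midpoints are scale-free: the mesh-`δ` drawing at the mesh-`δ` midpoint of
`e` winds as the mesh-`1` drawing at the mesh-`1` midpoint. -/
theorem wind_loopCurve_medialPoint_mesh (hδ : δ ≠ 0) (γ : List MedialVertex) (e : MedialVertex) :
    (loopCurve δ 0 γ).wind (medialPoint δ e) = (loopCurve 1 0 γ).wind (medialPoint 1 e) := by
  rw [wind_loopCurve_mesh hδ, OrbitPolygon.medialPoint_eq_mul_one δ e,
    mul_div_cancel_left₀ _ (Complex.ofReal_ne_zero.2 hδ)]

/-- Strict inclusion of winding interiors is scale-free. -/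
theorem setOf_wind_ssubset_iff_mesh (hδ : δ ≠ 0) (γ' γ : List MedialVertex) :
    {z | (loopCurve δ 0 γ').wind z ≠ 0} ⊂ {z | (loopCurve δ 0 γ).wind z ≠ 0} ↔
      {z | (loopCurve 1 0 γ').wind z ≠ 0} ⊂ {z | (loopCurve 1 0 γ).wind z ≠ 0} := by
  rw [setOf_wind_loopCurve_mesh hδ γ', setOf_wind_loopCurve_mesh hδ γ]
  have hsurj : Surjective fun z : ℂ ↦ z / δ := fun w ↦
    ⟨w * δ, mul_div_cancel_right₀ w (Complex.ofReal_ne_zero.2 hδ)⟩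
  rw [ssubset_iff_subset_not_subset, ssubset_iff_subset_not_subset,
    hsurj.preimage_subset_preimage_iff, hsurj.preimage_subset_preimage_iff]

/-- **Key lemma (mesh `δ ≠ 0`).** -/
theorem wind_medialPoint_eq_zero_of_not_ssubset_mesh (hδ : δ ≠ 0) (h : IsInterfaceLoop ω γ)
    (h' : IsInterfaceLoop ω γ')
    (hnot : ¬ {z | (loopCurve δ 0 γ').wind z ≠ 0} ⊂ {z | (loopCurve δ 0 γ).wind z ≠ 0})
    {e : MedialVertex} (he : e ∈ γ') : (loopCurve δ 0 γ).wind (medialPoint δ e) = 0 := by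
  rw [wind_loopCurve_medialPoint_mesh hδ]
  exact wind_medialPoint_eq_zero_of_not_ssubset h h'
    (fun hss ↦ hnot ((setOf_wind_ssubset_iff_mesh hδ γ' γ).2 hss)) he

/-! ## Loops of the domain ensemble -/

/-- A loop of the domain ensemble is the drawn loop of an interface loop of the closed-b.c.
configuration `ω ∩ meshEdges U δ` visiting an edge of `meshEdges U δ`. -/
theorem exists_eq_mk_of_mem_loops_domLoopsZ2 {u : UnbasedLoop ℂ}
    (hu : u ∈ (domLoopsZ2 U δ ω).loops) :
    ∃ (L : List MedialVertex) (h : IsInterfaceLoop (ω ∩ meshEdges U δ) L),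
      (∃ e ∈ L, e ∈ meshEdges U δ) ∧
        u = UnbasedLoop.mk (BasedLoop.mk (loopCurve δ 0 L) (isLoop_loopCurve δ 0 h.ne_nil)) := by
  rcases hu with hu | hu <;> obtain ⟨L, h, -, hvis, rfl⟩ := hu <;> exact ⟨L, h, hvis, rfl⟩

/-- Conversely, the drawn loop of an interface loop of `ω ∩ meshEdges U δ` visiting an edge of
`meshEdges U δ` is a loop of the domain ensemble (of type `loopType`). -/
theorem mk_mem_loops_domLoopsZ2 (h : IsInterfaceLoop (ω ∩ meshEdges U δ) γ)
    (hvis : ∃ e ∈ γ, e ∈ meshEdges U δ) :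
    UnbasedLoop.mk (BasedLoop.mk (loopCurve δ 0 γ) (isLoop_loopCurve δ 0 h.ne_nil)) ∈
      (domLoopsZ2 U δ ω).loops :=
  LoopConfig.subset_loops _ (loopType γ) ⟨γ, h, rfl, hvis, rfl⟩

/-! ## First-generation loops survive; loops not strictly inside them come back -/

/-- **A first-generation loop of `β = ω ∩ meshEdges U δ` is an interface loop of
`β' = ω' ∩ meshEdges U δ`** when `ω, ω'` agree off the strict interiors of the first generation:
its entries are strictly inside no first-generation loop (key lemma), so `β` and `β'` agree on
them (cylinder property). -/
theorem isInterfaceLoop_of_mk_mem_firstGen (hδ : δ ≠ 0)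
    (H : ∀ e : Sym2 (Site 2), (∀ u ∈ (firstGen (domLoopsZ2 U δ ω)).loops,
      u.wind (medialPoint δ e) = 0) → (e ∈ ω ↔ e ∈ ω'))
    (h : IsInterfaceLoop (ω ∩ meshEdges U δ) γ)
    (hG : UnbasedLoop.mk (BasedLoop.mk (loopCurve δ 0 γ) (isLoop_loopCurve δ 0 h.ne_nil)) ∈
      (firstGen (domLoopsZ2 U δ ω)).loops) :
    IsInterfaceLoop (ω' ∩ meshEdges U δ) γ := by
  have hiff : ∀ e ∈ γ, (e ∈ ω ∩ meshEdges U δ ↔ e ∈ ω' ∩ meshEdges U δ) := by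
    intro e he
    simp only [mem_inter_iff]
    refine and_congr_left' (H e fun u hu ↦ ?_)
    obtain ⟨γ₂, h₂, -, rfl⟩ := exists_eq_mk_of_mem_loops_domLoopsZ2 (loops_firstGen_subset _ hu)
    exact wind_medialPoint_eq_zero_of_not_ssubset_mesh hδ h₂ h
      ((mem_loops_firstGen_iff.1 hG).2 _ (loops_firstGen_subset _ hu)) he
  exact isInterfaceLoop_of_forall_mem_iff hiff h

/-- **An interface loop of `β'` strictly inside no first-generation loop of `β` is an interface
loop of `β`**: the key lemma in the configuration `β'`, between the loop and the first-generation
loops of `β` (interface loops of `β'` by `isInterfaceLoop_of_mk_mem_firstGen`). -/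
theorem isInterfaceLoop_of_forall_not_ssubset (hδ : δ ≠ 0)
    (H : ∀ e : Sym2 (Site 2), (∀ u ∈ (firstGen (domLoopsZ2 U δ ω)).loops,
      u.wind (medialPoint δ e) = 0) → (e ∈ ω ↔ e ∈ ω'))
    (h' : IsInterfaceLoop (ω' ∩ meshEdges U δ) γ')
    (hns : ∀ v ∈ (firstGen (domLoopsZ2 U δ ω)).loops,
      ¬ ({z | (loopCurve δ 0 γ').wind z ≠ 0} ⊂ {z | v.wind z ≠ 0})) :
    IsInterfaceLoop (ω ∩ meshEdges U δ) γ' := by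
  have hiff : ∀ e ∈ γ', (e ∈ ω' ∩ meshEdges U δ ↔ e ∈ ω ∩ meshEdges U δ) := by
    intro e he
    simp only [mem_inter_iff]
    refine (and_congr_left' (H e fun u hu ↦ ?_)).symm
    obtain ⟨γ₂, h₂, -, rfl⟩ := exists_eq_mk_of_mem_loops_domLoopsZ2 (loops_firstGen_subset _ hu)
    exact wind_medialPoint_eq_zero_of_not_ssubset_mesh hδ
      (isInterfaceLoop_of_mk_mem_firstGen hδ H h₂ hu) h' (hns _ hu) he
  exact isInterfaceLoop_of_forall_mem_iff hiff h'

/-! ## The registered helper -/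

/-- **The first generation of the closed-b.c. bond-`ℤ²` domain ensemble is a STOPPING SET**
(registered helper `firstGen_domLoopsZ2_eq_of_agree_outside`, wave 3, toward
`stub_cascadeReconstruction`; combinatorial half of the domain Markov property): for `δ > 0` and
bounded `U`, two bond configurations agreeing on every edge whose mesh-`δ` midpoint is strictly
inside no first-generation loop of `domLoopsZ2 U δ ω` have the same first generation. -/
theorem firstGen_domLoopsZ2_eq_of_agree_outside : ∀ (U : Set ℂ) (δ : ℝ) (ω ω' : BondConfig (Site 2)), 0 < δ → Bornology.IsBounded U → (∀ e : Sym2 (Site 2), (∀ u ∈ (firstGen (domLoopsZ2 U δ ω)).loops, u.wind (medialPoint δ e) = 0) → (e ∈ ω ↔ e ∈ ω')) → firstGen (domLoopsZ2 U δ ω') = firstGen (domLoopsZ2 U δ ω) := by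
  intro U δ ω ω' hδ hU H
  ext i u
  constructor
  · rintro ⟨hu', hmax'⟩
    obtain ⟨L', h', ht, hvis, rfl⟩ := hu'
    -- `L'` is strictly inside no first-generation loop of `β` (these are loops of `β'`)
    have hns : ∀ v ∈ (firstGen (domLoopsZ2 U δ ω)).loops,
        ¬ ({z | (loopCurve δ 0 L').wind z ≠ 0} ⊂ {z | v.wind z ≠ 0}) := by
      intro v hv hss
      obtain ⟨γ₂, h₂, hvis₂, rfl⟩ :=
        exists_eq_mk_of_mem_loops_domLoopsZ2 (loops_firstGen_subset _ hv)
      exact hmax' _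
        (mk_mem_loops_domLoopsZ2 (isInterfaceLoop_of_mk_mem_firstGen hδ.ne' H h₂ hv) hvis₂) hss
    have hL : IsInterfaceLoop (ω ∩ meshEdges U δ) L' :=
      isInterfaceLoop_of_forall_not_ssubset hδ.ne' H h' hns
    refine ⟨⟨L', hL, ht, hvis, rfl⟩, fun v hv hss ↦ ?_⟩
    -- a loop of `β` strictly enclosing `L'` is enclosed by a first-generation loop of `β`
    obtain ⟨w, hw, hvw⟩ := exists_mem_firstGen_domLoopsZ2 hU hδ hv
    exact hns w hw (hss.trans_le hvw)
  · rintro ⟨hu, hmax⟩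
    have hG : u ∈ (firstGen (domLoopsZ2 U δ ω)).loops := LoopConfig.subset_loops _ i ⟨hu, hmax⟩
    obtain ⟨γ, h, ht, hvis, rfl⟩ := hu
    refine ⟨⟨γ, isInterfaceLoop_of_mk_mem_firstGen hδ.ne' H h hG, ht, hvis, rfl⟩,
      fun v hv hss ↦ ?_⟩
    -- a loop of `β'` strictly enclosing `γ` is strictly inside no first-generation loop of `β`
    obtain ⟨L', hL', hvis', rfl⟩ := exists_eq_mk_of_mem_loops_domLoopsZ2 hv
    have hns : ∀ w ∈ (firstGen (domLoopsZ2 U δ ω)).loops,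
        ¬ ({z | (loopCurve δ 0 L').wind z ≠ 0} ⊂ {z | w.wind z ≠ 0}) := fun w hw hss' ↦
      hmax w (loops_firstGen_subset _ hw) (hss.trans hss')
    exact hmax _ (mk_mem_loops_domLoopsZ2 (isInterfaceLoop_of_forall_not_ssubset hδ.ne' H hL' hns)
      hvis') hss

end Summit.CriticalPhenomena.CardyFormulaZ2.Cruxes.NestingRigidity.MarkovCascadeOneGeneration

end
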